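import Literature.MathematicalPhysics.QuantumFieldTheory.Balaban1983to89.T4TowerDecorrelation

/-!
# T4 — the CONDITIONAL-MEAN CHANNEL: cross-level covariance of levelled pieces
# (kernel K7 of the O3.E-ii line; surge node `T4-O3.E-ii-MEANCH*`, pv18 lineage)

Position in the cell's T4 programme (pub-balaban, `t4/T4-DAG.md` v8 §5): a NEW small leaf on
top of K6 = `T4TowerDecorrelation` (imported, and through it K5 = `T4PairDecorrelation` and
K10/K11 = `T4CoReadMoment`).  It serves the carver's row `T4-O3.E-ii-CDEC°` («THE NUMBER
C_dec … for Bałaban's actual conditional one-step laws given the exterior») on its KERNEL side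
only, by typing WHERE the second located number ν of K6 lives.

## HONEST FRAMING (read first)

Nothing in this file is an estimate for Bałaban's renormalization transformations, and nothing
of any manuscript is asserted.  Every declaration is `[folklore]` measure theory (Mathlib's
conditional expectation `μ[f | m]`, its tower and pull-out properties) or finite-sum real
analysis over PLAIN DATA: a measure `μ`, a finite index set `s`, real pieces `X p`, scales
`σ p`, a kernel `κ`, a level map `lvl : ι → ℕ`, an ANTITONE family of sub-σ-algebras
`F : ℕ → MeasurableSpace Ω` («the field seen from level `j` upward») and numbers `B, Λ, ν`.
No declaration carries a citation tag.  The value of the module is a kernel IDENTITY that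
re-routes a located item (below); it is NOT summit progress and changes no count of the cell's
residual ledger (NE1′ = {NE1a-STEP, NE1(ii) = RATE + DECORR, NE2-PS}).

## CITATION HEADER

This module quotes NO sentence of the Bałaban corpus.  The printed CONTEXT of the line is the
one already quoted verbatim (render re-read as image by pv18-g7, certified by the cross-read
C-pv12g8-2) in the header of the imported `T4TowerDecorrelation`: [Balaban1988RG2Cluster]
CMP 116 p.21, the one-step cluster expansion's connected parts (2.39)–(2.40) with the activity
bounds (2.38) p.20 inserted — exponential tree decay of ONE step's ACTIVITIES.  As recorded there
and in the cell's GAPS (G-pv18g6-1, its pv18-g7 UPDATE, C-pv18g7-1): correlations between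
observable pieces BORN AT DIFFERENT STEPS of a tower, under a conditional law, are printed
NOWHERE in [B5]–[B16].  The filtration reading below is CELL ANALYSIS (labelled), not a fact of
the literature.

## THE LOCATED ITEM SERVED (cell text, GAPS G-pv18g6-1 UPDATE (pv18-g7), item (3), abridged)

«the instance to be SUPPLIED … is: (B) SAME-GAP budget … (ν) CROSS-GAP decay — for a piece p
and the ≍ G₀Λ^g pieces q nested g ≥ 1 levels below it in its tower, κ(p,q) ≤ A_κν^g …, with
L⁴·ν·θ₁ < 1 …; heuristic size [NOT kernel]: ν ≍ Λ^{−1/2} … WHERE IT WOULD COME FROM: ν is a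
property of the COMPOSITION of the one-step conditional laws along a tower with two observable
insertions at different depths».

## DICTIONARY (cell analysis, located, NOT a fact)

Under the COMPOSED law of a tower of steps, write `F j` for the σ-algebra generated by the
fields of the levels `≥ j` (the unit-lattice field is recovered from all of them; integrating
OUT the level-`j` fluctuation field is passing from `F j` to `F (j + 1)`), so `F` is ANTITONE.
A piece born at level `j` — a D-term of birth scale `j` in the format of `T4TermFormat`, a
co-read pair piece `ℓ[B_p]` of `T4CoReadMoment` — is a function of the fields of levels `≥ j`,
i.e. `F j`-measurable: hypothesis `hXm : StronglyMeasurable[F (lvl p)] (X p)`.  «Centred under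
the one-step conditional law given the exterior» (D11 / row AX*, `pairMeanField_eq_zero` at a
flat exterior, O-G7 off flat) is CONDITIONAL CENTRING one level up:
`hXc : μ[X p | F (lvl p + 1)] =ᵐ[μ] 0`.

## WHAT IS TYPED AND PROVED (all [folklore]; K14a–K14x)

§1 THE CHANNEL (one pair, one sub-σ-algebra `m ≤ mΩ`):
* (K14b) `integral_mul_eq_integral_mul_condExp` — `f` `m`-measurable, `g` and `f·g` integrable
  ⇒ `∫ f·g dμ = ∫ f·μ[g | m] dμ`: a coarse observable sees a finer one ONLY THROUGH THE FINER
  ONE'S CONDITIONAL MEAN given the coarse σ-algebra («the mean channel»); (K14b′) mirror form.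
* (K14c) `integral_mul_eq_zero_of_condExp_ae_eq_zero` — `μ[g | m] =ᵐ 0` ⇒ `∫ f·g dμ = 0`.
* (K14d) `abs_integral_mul_le_mul_integral_abs_condExp` — `|f| ≤ b` ⇒
  `|∫ f·g| ≤ b·∫|μ[g | m]|`; (K14e) `abs_integral_mul_le_sqrt_mul_sqrt_condExp` —
  `|∫ f·g| ≤ ‖f‖₂·‖μ[g | m]‖₂` (Cauchy–Schwarz (K14e₀) from integrability only).
* (K14f) `ae_abs_condExp_le` — `|f| ≤ R` everywhere ⇒ `|μ[f | m]| ≤ R` a.e. (Mathlib, by name).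

§2 LEVELLED FAMILIES (`F` antitone, `X p` `F (lvl p)`-measurable and bounded, `μ` finite):
* (K14h) `integral_mul_eq_integral_mul_condExp_level` — for ALL `p q ∈ s`:
  `∫ X_p X_q dμ = ∫ X_p · μ[X_q | F (lvl p)] dμ` (content when `lvl q < lvl p`); (K14h′) the
  one-level-up form `… = ∫ X_p · μ[X_q | F (lvl q + 1)] dμ` for `lvl q < lvl p`; (K14h″) the
  same with an arbitrary bounded `V` in place of `X_q`, and its L² bound (K14h‴)
  `|∫ X_p V| ≤ ‖X_p‖₂ · ‖μ[V | F (lvl p)]‖₂` — the coarse piece sees the whole finer family `V`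
  only through `μ[V | F (lvl p)]`.
* (K14i) `integral_mul_eq_zero_of_lvl_ne` — conditionally centred pieces at DIFFERENT levels
  are EXACTLY orthogonal; (K14i′) conditional centring ⇒ `∫ X_p dμ = 0`.
* (K14j–l) `sameLevel lvl κ` (the kernel `κ` restricted to equal levels) and the INSTANCES:
  `pairDecorrelation_sameLevel` — conditionally centred pieces + a same-level covariance kernel
  with same-level row/column sums `≤ B` ⇒ K5's `PairDecorrelation μ s X σ (sameLevel lvl κ) B`
  (ONE number again, now level-local); `towerDecorrelation_sameLevel` — the same data ⇒ K6's
  `TowerDecorrelation μ s X σ (sameLevel lvl κ) lvl B Λ 0`, i.e. **ν = 0**.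
* (K14m) the measure chain for such families: `integral_sq_sum_le_of_condCentred`
  (`∫(Σ c_pX_p)² ≤ B·Σ(c_pσ_p)²`) and `log_integral_exp_neg_sum_le_line_of_condCentred`
  (`0 ≤ log∫e^{−Σ c_pX_p} ≤ B·N₀A/(1−r)` under the K11a bookkeeping — K5's headline BY NAME,
  with NO cross-gap condition at all).
* (K14w) SUPPLIER of K6's levelled clause FROM THE MEAN CHANNEL, for pieces that are NOT
  conditionally centred: `towerDecorrelation_of_meanChannel` — a same-level-type decorrelation
  of each piece `X_p` against the level-`lvl p` CONDITIONAL MEANS `μ[X_q | F (lvl p)]` of the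
  finer pieces, of size `κ₀(p,q)·ν^{gap}·σ_pσ_q`, with down-slice sums `Σ κ₀(p,·) ≤ B·Λ^g` and
  the transposed same-level sum `≤ B` ⇒ `TowerDecorrelation μ s X σ (meanKernel lvl κ₀ ν) lvl B
  Λ ν`: BOTH orientations of K6's clause are booked from the coarse end through the channel.

§3 DOOB–LÉVY INCREMENTS (`incr μ F f i := μ[f | F i] − μ[f | F (i + 1)]`):
* (K14p) `condExp_incr_ae_eq_zero` — increments are conditionally centred one level up (tower
  property); (K14r) `integral_incr_mul_incr_eq_zero` — increments of two bounded observables at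
  DIFFERENT levels are orthogonal (ν = 0 for increments, no hypothesis on the law beyond
  finiteness); (K14s) telescoping `μ[f | F j] = μ[f | F (j+n)] + Σ_{i<n} incr (j+i)`;
  (K14t) `integral_sq_sum_eq_sum_integral_sq` — EXACT level decoupling of the second moment of
  a sum of level-adapted, conditionally centred summands; (K14u) the variance of
  `μ[f | F j] − μ[f | F (j+n)]` is the SUM of the increments' second moments.

§4 BLOCKWISE READING (calibration): (K14v) pieces each conditionally centred given a σ-algebra
making all OTHER pieces measurable are pairwise orthogonal ⇒ K5's shape at `C = 1`
(`PairDecorrelation.of_uncorrelated` BY NAME).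

## READINGS (cell analysis, located, NOT kernel beyond the statements above, NOT printed)

(R1) ν IS THE MEAN CHANNEL.  By (K14h) the cross-gap entries of K6's kernel are not two-body
correlation coefficients of the pieces but ONE-BODY data of the finer piece seen at the coarser
level: `|∫X_pX_q| ≤ ‖X_p‖₂·‖μ[X_q | F (lvl p)]‖₂` (K14e).  Hence the cross-gap decay ν of
G-pv18g6-1 UPDATE (3) is the per-level CONTRACTION of conditional means of a centred local
piece under further conditionings up the tower, `‖μ[X_q | F (lvl q + g)]‖₂ ≲ ν^g σ_q`, times the
SAME-LEVEL decorrelation of `X_p` against that smoothed piece (K14w's hypothesis `hmean`):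
the two-insertions-at-different-depths property is reduced to (same-level two-body decay B) ×
(one-body smoothing ν) × (nested counts Λ^g) — (K14w) is exactly this bookkeeping.  The
smoothing rate is an averaging-operator property of the kind O-G7 measures one step at a time
(`T4CoReadMoment.pairMean_norm_le_of_lipschitz`: conditional mean ≲ Lipschitz modulus ×
deviation); its value for Bałaban's laws is NOT estimated here and NOT printed.
(R2) ν = 0 FOR CONDITIONALLY CENTRED PIECES.  If each piece is centred under the one-step law
given everything above it (`hXc`), all cross-gap covariances VANISH (K14i) and K6's clause holds
with ν = 0 (K14l): the instance of NE1(ii)-DECORR is then ONE level-local number B (K14k/m),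
with no threshold `Λντ < 1` to meet.  The record's heuristic «ν ≍ Λ^{−1/2}» (O3Eii v1.8 §0 (l)
(β)) describes GLOBALLY centred pieces; their cross-gap covariance is carried entirely by the
conditional means `μ[X_q | F (lvl q + 1)] ≠ 0` (K14h′), i.e. by the failure of conditional
centring — for the co-read pair pieces this is the O-G7 item (centring off a flat exterior),
which therefore feeds ν and not only σ (sharpening G-pv18g6-1 (ii)).
(R3) DOOB SPLIT.  Any bounded piece splits as `X_q = (X_q − μ[X_q | F (lvl q + 1)]) + μ[X_q |
F (lvl q + 1)]`: a conditionally centred part (ν = 0 by (R2)) plus a piece living one level UP;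
iterating, `μ[f | F j] − μ[f | F (j+n)]` is an orthogonal sum of increments (K14s–u).  Re-filed
by the level at which they live, the increments of all pieces form a conditionally centred
levelled family to which (K14k–m) apply with ν = 0; the price is paid in the SIZES (the profile
hypothesis `(c_pσ_p)² ≤ A(τ²)^{K−lvl}` must then hold for the smoothed increments at their new
levels — again the one-body contraction of (R1)) and in the same-level budget B for increments.
This module types the identities; the re-filing bookkeeping is NOT typed here.
(R4) LIMIT OF THE BLOCKWISE READING (K14v).  Dobrushin-type conditional centring given the
complement block makes DISTINCT pieces orthogonal only when each other piece is measurable with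
respect to the conditioning σ-algebra (disjoint supports); Doob-corrected pieces
`X_q − μ[X_q | G_q]` are functions of the whole field and do NOT satisfy that hypothesis — the
levelled (nested) filtration of §2–§3 is the structure that survives correction, which is why
the module is built on it.

## LOCATED ITEMS NOT TOUCHED (none printed, none kernel)

(B) the same-level budget for Bałaban's conditional laws (row CDEC°; context B13 §2 pp.20–21);
(ν) the one-body contraction rate of conditional means of centred local pieces up the tower
(R1) — by this module the ONLY place where a cross-gap number enters; the centring modulus off a
flat exterior (O-G7, row G7°); the increments' re-filing bookkeeping (R3).  value = kernel
identity + hypothesis shapes, NOT summit progress.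
-/

noncomputable section

open MeasureTheory Finset
open scoped BigOperators

namespace Literature.MathematicalPhysics.QuantumFieldTheory.Balaban1983to89.T4MeanChannel

open Literature.MathematicalPhysics.QuantumFieldTheory.Balaban1983to89.T4CoReadMoment
open Literature.MathematicalPhysics.QuantumFieldTheory.Balaban1983to89.T4PairDecorrelation
open Literature.MathematicalPhysics.QuantumFieldTheory.Balaban1983to89.T4TowerDecorrelation

/-! ## §1  The conditional-mean channel for one pair (K14a–K14f) -/

section Channel

variable {Ω : Type*} {mΩ : MeasurableSpace Ω} {μ : Measure Ω}

/-- (K14a) [folklore] Integrability helper: an a.e.-strongly measurable function bounded by a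
constant times an integrable function is integrable (Mathlib `Integrable.mul_bdd`, arguments in
the order used below). -/
theorem integrable_mul_of_abs_le_left {f g : Ω → ℝ} (hf : AEStronglyMeasurable f μ) {b : ℝ}
    (hfb : ∀ ω, |f ω| ≤ b) (hg : Integrable g μ) : Integrable (fun ω => f ω * g ω) μ :=
  (hg.mul_bdd hf (Filter.Eventually.of_forall fun ω => by
    rw [Real.norm_eq_abs]; exact hfb ω)).congr (ae_of_all μ fun ω => mul_comm (g ω) (f ω))

/-- (K14a″) [folklore] An a.e.-bounded a.e.-strongly measurable function on a finite measure
space is integrable. -/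
theorem integrable_of_ae_abs_le [IsFiniteMeasure μ] {u : Ω → ℝ} (hum : AEStronglyMeasurable u μ)
    {bu : ℝ} (hu : ∀ᵐ ω ∂μ, |u ω| ≤ bu) : Integrable u μ :=
  (integrable_const bu).mono' hum (hu.mono fun ω h => by rw [Real.norm_eq_abs]; exact h)

/-- (K14a‴) [folklore] … and so is its square. -/
theorem integrable_sq_of_ae_abs_le [IsFiniteMeasure μ] {u : Ω → ℝ}
    (hum : AEStronglyMeasurable u μ) {bu : ℝ} (hu : ∀ᵐ ω ∂μ, |u ω| ≤ bu) :
    Integrable (fun ω => u ω ^ 2) μ :=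
  (integrable_const (bu ^ 2)).mono' (hum.pow 2) (hu.mono fun ω h => by
    rw [Real.norm_eq_abs, abs_pow]
    exact pow_le_pow_left₀ (abs_nonneg _) h 2)

/-- (K14b) [folklore] **THE MEAN CHANNEL.**  If `f` is measurable with respect to the
sub-σ-algebra `m` («coarse») and `g`, `f·g` are integrable, then
`∫ f·g dμ = ∫ f·μ[g | m] dμ`: the coarse observable `f` sees `g` only through the conditional
mean of `g` given `m`.  (Mathlib: `integral_condExp` + the pull-out property
`condExp_mul_of_stronglyMeasurable_left`.)  This identity is the whole content of the module;
everything below is bookkeeping around it. -/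
theorem integral_mul_eq_integral_mul_condExp {m : MeasurableSpace Ω} (hm : m ≤ mΩ)
    [SigmaFinite (μ.trim hm)] {f g : Ω → ℝ} (hf : StronglyMeasurable[m] f) (hg : Integrable g μ)
    (hfg : Integrable (fun ω => f ω * g ω) μ) :
    ∫ ω, f ω * g ω ∂μ = ∫ ω, f ω * μ[g | m] ω ∂μ := by
  have hfg' : Integrable (f * g) μ := hfg
  calc ∫ ω, f ω * g ω ∂μ = ∫ ω, (f * g) ω ∂μ := rfl
    _ = ∫ ω, μ[f * g | m] ω ∂μ := (integral_condExp hm).symm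
    _ = ∫ ω, f ω * μ[g | m] ω ∂μ := by
        refine integral_congr_ae ?_
        filter_upwards [condExp_mul_of_stronglyMeasurable_left hf hfg' hg] with ω hω
        simpa only [Pi.mul_apply] using hω

/-- (K14b′) [folklore] Mirror form of (K14b): the coarse factor on the right. -/
theorem integral_mul_eq_integral_condExp_mul {m : MeasurableSpace Ω} (hm : m ≤ mΩ)
    [SigmaFinite (μ.trim hm)] {f g : Ω → ℝ} (hf : StronglyMeasurable[m] f) (hg : Integrable g μ)
    (hgf : Integrable (fun ω => g ω * f ω) μ) :
    ∫ ω, g ω * f ω ∂μ = ∫ ω, μ[g | m] ω * f ω ∂μ := by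
  have hfg : Integrable (fun ω => f ω * g ω) μ :=
    hgf.congr (ae_of_all μ fun ω => mul_comm (g ω) (f ω))
  calc ∫ ω, g ω * f ω ∂μ = ∫ ω, f ω * g ω ∂μ :=
        integral_congr_ae (ae_of_all μ fun ω => mul_comm (g ω) (f ω))
    _ = ∫ ω, f ω * μ[g | m] ω ∂μ := integral_mul_eq_integral_mul_condExp hm hf hg hfg
    _ = ∫ ω, μ[g | m] ω * f ω ∂μ :=
        integral_congr_ae (ae_of_all μ fun ω => mul_comm (f ω) (μ[g | m] ω))

/-- (K14c) [folklore] **ORTHOGONALITY THROUGH THE CHANNEL.**  If the conditional mean of `g`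
given `m` vanishes a.e., then `g` is orthogonal to every `m`-measurable `f` with `f·g`
integrable. -/
theorem integral_mul_eq_zero_of_condExp_ae_eq_zero {m : MeasurableSpace Ω} (hm : m ≤ mΩ)
    [SigmaFinite (μ.trim hm)] {f g : Ω → ℝ} (hf : StronglyMeasurable[m] f) (hg : Integrable g μ)
    (hfg : Integrable (fun ω => f ω * g ω) μ) (h0 : μ[g | m] =ᵐ[μ] 0) :
    ∫ ω, f ω * g ω ∂μ = 0 := by
  rw [integral_mul_eq_integral_mul_condExp hm hf hg hfg]
  have h : (fun ω => f ω * μ[g | m] ω) =ᵐ[μ] fun _ => (0 : ℝ) := by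
    filter_upwards [h0] with ω hω
    rw [hω, Pi.zero_apply, mul_zero]
  rw [integral_congr_ae h, integral_zero]

/-- (K14d) [folklore] **L¹ FORM OF THE CHANNEL BOUND.**  `|f| ≤ b` everywhere ⇒
`|∫ f·g dμ| ≤ b · ∫ |μ[g | m]| dμ`. -/
theorem abs_integral_mul_le_mul_integral_abs_condExp {m : MeasurableSpace Ω} (hm : m ≤ mΩ)
    [SigmaFinite (μ.trim hm)] {f g : Ω → ℝ} (hf : StronglyMeasurable[m] f) (hg : Integrable g μ)
    (hfg : Integrable (fun ω => f ω * g ω) μ) {b : ℝ} (hfb : ∀ ω, |f ω| ≤ b) :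
    |∫ ω, f ω * g ω ∂μ| ≤ b * ∫ ω, |μ[g | m] ω| ∂μ := by
  rw [integral_mul_eq_integral_mul_condExp hm hf hg hfg]
  have hci : Integrable (μ[g | m]) μ := integrable_condExp
  calc |∫ ω, f ω * μ[g | m] ω ∂μ| ≤ ∫ ω, |f ω * μ[g | m] ω| ∂μ := abs_integral_le_integral_abs
    _ ≤ ∫ ω, b * |μ[g | m] ω| ∂μ :=
        integral_mono_of_nonneg (Filter.Eventually.of_forall fun ω => abs_nonneg _)
          (hci.abs.const_mul b)
          (Filter.Eventually.of_forall fun ω => by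
            show |f ω * μ[g | m] ω| ≤ b * |μ[g | m] ω|
            rw [abs_mul]
            exact mul_le_mul_of_nonneg_right (hfb ω) (abs_nonneg _))
    _ = b * ∫ ω, |μ[g | m] ω| ∂μ := integral_const_mul _ _

/-- (K14e₀) [folklore] Cauchy–Schwarz for `∫ f·g dμ` from integrability of `f²`, `g²`, `f·g`
only (discriminant argument, as in K5's `abs_integral_mul_le_sqrt_mul_sqrt`, whose binders are
pointwise bounds instead). -/
theorem abs_integral_mul_le_sqrt_mul_sqrt_of_integrable {f g : Ω → ℝ}
    (hf2 : Integrable (fun ω => f ω ^ 2) μ) (hg2 : Integrable (fun ω => g ω ^ 2) μ)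
    (hfg : Integrable (fun ω => f ω * g ω) μ) :
    |∫ ω, f ω * g ω ∂μ| ≤ Real.sqrt (∫ ω, f ω ^ 2 ∂μ) * Real.sqrt (∫ ω, g ω ^ 2 ∂μ) := by
  have hquad : ∀ t : ℝ,
      0 ≤ (∫ ω, g ω ^ 2 ∂μ) * (t * t) + (-(2 * ∫ ω, f ω * g ω ∂μ)) * t + ∫ ω, f ω ^ 2 ∂μ := by
    intro t
    have hnn : 0 ≤ ∫ ω, (f ω - t * g ω) ^ 2 ∂μ := integral_nonneg fun ω => sq_nonneg _
    have heq : (fun ω => (f ω - t * g ω) ^ 2) =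
        fun ω => (f ω ^ 2 - 2 * t * (f ω * g ω)) + t ^ 2 * g ω ^ 2 := by
      funext ω; ring
    have hF : Integrable (fun ω => f ω ^ 2 - 2 * t * (f ω * g ω)) μ := hf2.sub (hfg.const_mul _)
    have hG : Integrable (fun ω => t ^ 2 * g ω ^ 2) μ := hg2.const_mul _
    have hG' : Integrable (fun ω => 2 * t * (f ω * g ω)) μ := hfg.const_mul _
    rw [heq, integral_add hF hG, integral_sub hf2 hG', integral_const_mul, integral_const_mul]
      at hnn
    nlinarith [hnn]
  have hd := discrim_le_zero hquad
  rw [discrim] at hd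
  have hA0 : 0 ≤ ∫ ω, f ω ^ 2 ∂μ := integral_nonneg fun ω => sq_nonneg _
  have hP2 : (∫ ω, f ω * g ω ∂μ) ^ 2 ≤ (∫ ω, f ω ^ 2 ∂μ) * ∫ ω, g ω ^ 2 ∂μ := by
    nlinarith [hd]
  rw [← Real.sqrt_mul hA0, ← Real.sqrt_sq_eq_abs]
  exact Real.sqrt_le_sqrt hP2

/-- (K14e) [folklore] **L² FORM OF THE CHANNEL BOUND.**
`|∫ f·g dμ| ≤ ‖f‖₂ · ‖μ[g | m]‖₂`: the covariance of a coarse piece with a finer one is bounded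
by the coarse piece's L² size times the L² size of the finer piece's CONDITIONAL MEAN — a
one-body quantity of the finer piece. -/
theorem abs_integral_mul_le_sqrt_mul_sqrt_condExp {m : MeasurableSpace Ω} (hm : m ≤ mΩ)
    [SigmaFinite (μ.trim hm)] {f g : Ω → ℝ} (hf : StronglyMeasurable[m] f) (hg : Integrable g μ)
    (hfg : Integrable (fun ω => f ω * g ω) μ) (hf2 : Integrable (fun ω => f ω ^ 2) μ)
    (hc2 : Integrable (fun ω => μ[g | m] ω ^ 2) μ)
    (hfc : Integrable (fun ω => f ω * μ[g | m] ω) μ) :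
    |∫ ω, f ω * g ω ∂μ| ≤
      Real.sqrt (∫ ω, f ω ^ 2 ∂μ) * Real.sqrt (∫ ω, μ[g | m] ω ^ 2 ∂μ) := by
  rw [integral_mul_eq_integral_mul_condExp hm hf hg hfg]
  exact abs_integral_mul_le_sqrt_mul_sqrt_of_integrable hf2 hc2 hfc

/-- (K14f) [folklore] A function bounded everywhere by `R` has conditional mean bounded a.e. by
`R` (Mathlib `ae_bdd_abs_condExp_of_ae_bdd_abs`, by name). -/
theorem ae_abs_condExp_le {m : MeasurableSpace Ω} {f : Ω → ℝ} {R : ℝ} (hf : ∀ ω, |f ω| ≤ R) :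
    ∀ᵐ ω ∂μ, |μ[f | m] ω| ≤ R :=
  ae_bdd_abs_condExp_of_ae_bdd_abs (Filter.Eventually.of_forall hf)

end Channel

/-! ## §2  Levelled families along an antitone filtration (K14g–K14n, K14w) -/

section Levels

variable {Ω : Type*} {mΩ : MeasurableSpace Ω} {μ : Measure Ω} {ι : Type*} {s : Finset ι}
  {X : ι → Ω → ℝ} {b σ : ι → ℝ} {κ : ι → ι → ℝ} {F : ℕ → MeasurableSpace Ω} {lvl : ι → ℕ}
  {B Λ : ℝ}

/-- (K14g₀) [folklore] Level-adapted pieces are a.e.-strongly measurable for the ambient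
σ-algebra. -/
theorem aestronglyMeasurable_of_level (hFle : ∀ j, F j ≤ mΩ)
    (hXm : ∀ p ∈ s, StronglyMeasurable[F (lvl p)] (X p)) :
    ∀ p ∈ s, AEStronglyMeasurable (X p) μ :=
  fun p hp => ((hXm p hp).mono (hFle (lvl p))).aestronglyMeasurable

/-- (K14g) [folklore] **ORTHOGONALITY ACROSS A LEVEL GAP (abstract).**  Along an antitone
filtration `F`, a function `u` adapted to level `a` and a function `v` conditionally centred
one level above its own level `a' < a` are orthogonal. -/
theorem integral_mul_eq_zero_of_level_lt [IsFiniteMeasure μ] (hF : Antitone F)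
    (hFle : ∀ j, F j ≤ mΩ) {u v : Ω → ℝ} {a a' : ℕ} (hlt : a' < a)
    (hu : StronglyMeasurable[F a] u) (hv : Integrable v μ)
    (huv : Integrable (fun ω => u ω * v ω) μ) (hvc : μ[v | F (a' + 1)] =ᵐ[μ] 0) :
    ∫ ω, u ω * v ω ∂μ = 0 := by
  haveI : SigmaFinite (μ.trim (hFle (a' + 1))) := inferInstance
  exact integral_mul_eq_zero_of_condExp_ae_eq_zero (hFle (a' + 1))
    (hu.mono (hF (Nat.succ_le_of_lt hlt))) hv huv hvc

/-- (K14h) [folklore] **CROSS-LEVEL COVARIANCE = MEAN CHANNEL AT THE COARSE LEVEL.**  For every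
two pieces of a levelled bounded family, `∫ X_p X_q dμ = ∫ X_p · μ[X_q | F (lvl p)] dμ`.  The
identity holds for all `p, q`; it has content when `lvl q < lvl p` (for `lvl q ≥ lvl p` the
conditional mean is `X_q` itself).  READING (R1): the cross-gap entries of K6's kernel are
one-body data of the finer piece seen at the coarser level. -/
theorem integral_mul_eq_integral_mul_condExp_level [IsFiniteMeasure μ] (hFle : ∀ j, F j ≤ mΩ)
    (hXm : ∀ p ∈ s, StronglyMeasurable[F (lvl p)] (X p)) (hXb : ∀ p ∈ s, ∀ ω, |X p ω| ≤ b p)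
    {p q : ι} (hp : p ∈ s) (hq : q ∈ s) :
    ∫ ω, X p ω * X q ω ∂μ = ∫ ω, X p ω * μ[X q | F (lvl p)] ω ∂μ := by
  haveI : SigmaFinite (μ.trim (hFle (lvl p))) := inferInstance
  have hXm' := aestronglyMeasurable_of_level (μ := μ) hFle hXm
  exact integral_mul_eq_integral_mul_condExp (hFle (lvl p)) (hXm p hp)
    (integrable_of_abs_le (hXm' q hq) (hXb q hq)) (integrable_mul_of_abs_le hXm' hXb hp hq)

/-- (K14h′) [folklore] The one-level-up form: for `lvl q < lvl p`,
`∫ X_p X_q dμ = ∫ X_p · μ[X_q | F (lvl q + 1)] dμ` — the covariance is carried by the conditional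
mean of the finer piece under «the one-step law given everything above it». -/
theorem integral_mul_eq_integral_mul_condExp_succ [IsFiniteMeasure μ] (hF : Antitone F)
    (hFle : ∀ j, F j ≤ mΩ) (hXm : ∀ p ∈ s, StronglyMeasurable[F (lvl p)] (X p))
    (hXb : ∀ p ∈ s, ∀ ω, |X p ω| ≤ b p) {p q : ι} (hp : p ∈ s) (hq : q ∈ s)
    (hlt : lvl q < lvl p) :
    ∫ ω, X p ω * X q ω ∂μ = ∫ ω, X p ω * μ[X q | F (lvl q + 1)] ω ∂μ := by
  haveI : SigmaFinite (μ.trim (hFle (lvl q + 1))) := inferInstance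
  have hXm' := aestronglyMeasurable_of_level (μ := μ) hFle hXm
  exact integral_mul_eq_integral_mul_condExp (hFle (lvl q + 1))
    ((hXm p hp).mono (hF (Nat.succ_le_of_lt hlt)))
    (integrable_of_abs_le (hXm' q hq) (hXb q hq)) (integrable_mul_of_abs_le hXm' hXb hp hq)

/-- (K14h″) [folklore] The channel for a piece against an ARBITRARY bounded observable `V`
(e.g. the weighted sum of all finer pieces): `∫ X_p V dμ = ∫ X_p · μ[V | F (lvl p)] dμ`. -/
theorem integral_mul_eq_integral_mul_condExp_level' [IsFiniteMeasure μ] (hFle : ∀ j, F j ≤ mΩ)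
    (hXm : ∀ p ∈ s, StronglyMeasurable[F (lvl p)] (X p)) (hXb : ∀ p ∈ s, ∀ ω, |X p ω| ≤ b p)
    {p : ι} (hp : p ∈ s) {V : Ω → ℝ} (hVm : AEStronglyMeasurable V μ) {bV : ℝ}
    (hVb : ∀ ω, |V ω| ≤ bV) :
    ∫ ω, X p ω * V ω ∂μ = ∫ ω, X p ω * μ[V | F (lvl p)] ω ∂μ := by
  haveI : SigmaFinite (μ.trim (hFle (lvl p))) := inferInstance
  have hXm' := aestronglyMeasurable_of_level (μ := μ) hFle hXm
  exact integral_mul_eq_integral_mul_condExp (hFle (lvl p)) (hXm p hp)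
    (integrable_of_abs_le hVm hVb)
    (integrable_mul_of_abs_le_left (hXm' p hp) (hXb p hp) (integrable_of_abs_le hVm hVb))

/-- (K14h‴) [folklore] **THE COARSE PIECE SEES THE FINER FAMILY ONLY THROUGH ITS CONDITIONAL
MEAN**: `|∫ X_p V dμ| ≤ ‖X_p‖₂ · ‖μ[V | F (lvl p)]‖₂` for every bounded observable `V`. -/
theorem abs_integral_mul_le_of_level [IsFiniteMeasure μ] (hFle : ∀ j, F j ≤ mΩ)
    (hXm : ∀ p ∈ s, StronglyMeasurable[F (lvl p)] (X p)) (hXb : ∀ p ∈ s, ∀ ω, |X p ω| ≤ b p)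
    {p : ι} (hp : p ∈ s) {V : Ω → ℝ} (hVm : AEStronglyMeasurable V μ) {bV : ℝ}
    (hVb : ∀ ω, |V ω| ≤ bV) :
    |∫ ω, X p ω * V ω ∂μ| ≤
      Real.sqrt (∫ ω, X p ω ^ 2 ∂μ) * Real.sqrt (∫ ω, μ[V | F (lvl p)] ω ^ 2 ∂μ) := by
  haveI : SigmaFinite (μ.trim (hFle (lvl p))) := inferInstance
  have hXm' := aestronglyMeasurable_of_level (μ := μ) hFle hXm
  have hcm : AEStronglyMeasurable (μ[V | F (lvl p)]) μ :=
    ((stronglyMeasurable_condExp (m := F (lvl p)) (μ := μ) (f := V)).mono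
      (hFle (lvl p))).aestronglyMeasurable
  have hcb : ∀ᵐ ω ∂μ, |μ[V | F (lvl p)] ω| ≤ bV := ae_abs_condExp_le hVb
  exact abs_integral_mul_le_sqrt_mul_sqrt_condExp (hFle (lvl p)) (hXm p hp)
    (integrable_of_abs_le hVm hVb)
    (integrable_mul_of_abs_le_left (hXm' p hp) (hXb p hp) (integrable_of_abs_le hVm hVb))
    (integrable_sq_of_abs_le (hXm' p hp) (hXb p hp)) (integrable_sq_of_ae_abs_le hcm hcb)
    (integrable_mul_of_abs_le_left (hXm' p hp) (hXb p hp) integrable_condExp)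

/-- (K14i) [folklore] **ν = 0 FOR CONDITIONALLY CENTRED PIECES.**  If every piece is centred
under the conditional law one level above its own (`μ[X p | F (lvl p + 1)] =ᵐ 0`), two pieces at
DIFFERENT levels are exactly orthogonal. -/
theorem integral_mul_eq_zero_of_lvl_ne [IsFiniteMeasure μ] (hF : Antitone F)
    (hFle : ∀ j, F j ≤ mΩ) (hXm : ∀ p ∈ s, StronglyMeasurable[F (lvl p)] (X p))
    (hXb : ∀ p ∈ s, ∀ ω, |X p ω| ≤ b p) (hXc : ∀ p ∈ s, μ[X p | F (lvl p + 1)] =ᵐ[μ] 0)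
    {p q : ι} (hp : p ∈ s) (hq : q ∈ s) (hne : lvl p ≠ lvl q) :
    ∫ ω, X p ω * X q ω ∂μ = 0 := by
  have hXm' := aestronglyMeasurable_of_level (μ := μ) hFle hXm
  rcases hne.lt_or_gt with h | h
  · have hc : (fun ω => X p ω * X q ω) = fun ω => X q ω * X p ω :=
      funext fun ω => mul_comm _ _
    rw [hc]
    exact integral_mul_eq_zero_of_level_lt hF hFle h (hXm q hq)
      (integrable_of_abs_le (hXm' p hp) (hXb p hp)) (integrable_mul_of_abs_le hXm' hXb hq hp)
      (hXc p hp)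
  · exact integral_mul_eq_zero_of_level_lt hF hFle h (hXm p hp)
      (integrable_of_abs_le (hXm' q hq) (hXb q hq)) (integrable_mul_of_abs_le hXm' hXb hp hq)
      (hXc q hq)

/-- (K14i′) [folklore] Conditional centring implies centring. -/
theorem integral_eq_zero_of_condExp_ae_eq_zero [IsFiniteMeasure μ] (hFle : ∀ j, F j ≤ mΩ)
    (hXc : ∀ p ∈ s, μ[X p | F (lvl p + 1)] =ᵐ[μ] 0) {p : ι} (hp : p ∈ s) :
    ∫ ω, X p ω ∂μ = 0 := by
  haveI : SigmaFinite (μ.trim (hFle (lvl p + 1))) := inferInstance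
  calc ∫ ω, X p ω ∂μ = ∫ ω, μ[X p | F (lvl p + 1)] ω ∂μ :=
        (integral_condExp (hFle (lvl p + 1))).symm
    _ = ∫ ω, (0 : Ω → ℝ) ω ∂μ := integral_congr_ae (hXc p hp)
    _ = 0 := by simp

/-- (K14j) [folklore] The SAME-LEVEL restriction of a kernel: `κ` on pairs of equal level,
`0` across levels. -/
def sameLevel (lvl : ι → ℕ) (κ : ι → ι → ℝ) (p q : ι) : ℝ :=
  if lvl p = lvl q then κ p q else 0

/-- [folklore] -/
theorem sameLevel_of_eq {p q : ι} (h : lvl p = lvl q) : sameLevel lvl κ p q = κ p q := by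
  unfold sameLevel; exact if_pos h

/-- [folklore] -/
theorem sameLevel_of_ne {p q : ι} (h : lvl p ≠ lvl q) : sameLevel lvl κ p q = 0 := by
  unfold sameLevel; exact if_neg h

/-- (K14j′) [folklore] Row sums of the same-level kernel are the same-level row sums of `κ`. -/
theorem sum_sameLevel_row (s : Finset ι) (lvl : ι → ℕ) (κ : ι → ι → ℝ) (p : ι) :
    ∑ q ∈ s, sameLevel lvl κ p q = ∑ q ∈ s.filter (fun q => lvl q = lvl p), κ p q := by
  rw [sum_filter]
  refine sum_congr rfl fun q _ => ?_
  by_cases h : lvl q = lvl p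
  · rw [if_pos h, sameLevel_of_eq h.symm]
  · rw [if_neg h, sameLevel_of_ne fun h' => h h'.symm]

/-- (K14j″) [folklore] Column sums likewise. -/
theorem sum_sameLevel_col (s : Finset ι) (lvl : ι → ℕ) (κ : ι → ι → ℝ) (q : ι) :
    ∑ p ∈ s, sameLevel lvl κ p q = ∑ p ∈ s.filter (fun p => lvl p = lvl q), κ p q := by
  rw [sum_filter]
  refine sum_congr rfl fun p _ => ?_
  by_cases h : lvl p = lvl q
  · rw [if_pos h, sameLevel_of_eq h]
  · rw [if_neg h, sameLevel_of_ne h]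

/-- (K14k) [folklore] **INSTANCE, ONE LEVEL-LOCAL NUMBER.**  A levelled bounded family,
CONDITIONALLY CENTRED one level up, with a same-level covariance kernel `κ` (domination only
asked for pairs of EQUAL level) whose same-level row and column sums are `≤ B`, satisfies K5's
level-blind shape `PairDecorrelation μ s X σ (sameLevel lvl κ) B` — with the SAME number `B`,
however many levels the family spans: across levels the pieces are orthogonal (K14i).  Not
printed; hypothesis shapes only. -/
theorem pairDecorrelation_sameLevel [IsFiniteMeasure μ] (hF : Antitone F) (hFle : ∀ j, F j ≤ mΩ)
    (hXm : ∀ p ∈ s, StronglyMeasurable[F (lvl p)] (X p)) (hXb : ∀ p ∈ s, ∀ ω, |X p ω| ≤ b p)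
    (hXc : ∀ p ∈ s, μ[X p | F (lvl p + 1)] =ᵐ[μ] 0) (hσ : ∀ p ∈ s, 0 ≤ σ p)
    (hκ : ∀ p ∈ s, ∀ q ∈ s, 0 ≤ κ p q)
    (hcov : ∀ p ∈ s, ∀ q ∈ s, lvl p = lvl q →
      |∫ ω, X p ω * X q ω ∂μ| ≤ κ p q * (σ p * σ q))
    (hrow : ∀ p ∈ s, ∑ q ∈ s.filter (fun q => lvl q = lvl p), κ p q ≤ B)
    (hcol : ∀ p ∈ s, ∑ q ∈ s.filter (fun q => lvl q = lvl p), κ q p ≤ B) :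
    PairDecorrelation μ s X σ (sameLevel lvl κ) B where
  σ_nonneg := hσ
  κ_nonneg p hp q hq := by
    by_cases h : lvl p = lvl q
    · rw [sameLevel_of_eq h]; exact hκ p hp q hq
    · simp only [sameLevel_of_ne h, le_refl]
  cov_le p hp q hq := by
    by_cases h : lvl p = lvl q
    · rw [sameLevel_of_eq h]; exact hcov p hp q hq h
    · simp only [sameLevel_of_ne h, integral_mul_eq_zero_of_lvl_ne hF hFle hXm hXb hXc hp hq h,
        abs_zero, zero_mul, le_refl]
  row_le p hp := by rw [sum_sameLevel_row]; exact hrow p hp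
  col_le q hq := by rw [sum_sameLevel_col]; exact hcol q hq

/-- (K14l) [folklore] **INSTANCE OF K6's LEVELLED SHAPE WITH ν = 0.**  The same data give
`TowerDecorrelation μ s X σ (sameLevel lvl κ) lvl B Λ 0` for every `Λ`: the down-sums across a
gap `g ≥ 1` vanish identically, so K6's one new condition `Λντ ≤ ρ < 1` is met with `ρ = 0`.
READING (R2): for conditionally centred pieces the second located number of G-pv18g6-1 UPDATE
is not small but ZERO. -/
theorem towerDecorrelation_sameLevel [IsFiniteMeasure μ] (hF : Antitone F)
    (hFle : ∀ j, F j ≤ mΩ) (hXm : ∀ p ∈ s, StronglyMeasurable[F (lvl p)] (X p))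
    (hXb : ∀ p ∈ s, ∀ ω, |X p ω| ≤ b p) (hXc : ∀ p ∈ s, μ[X p | F (lvl p + 1)] =ᵐ[μ] 0)
    (hσ : ∀ p ∈ s, 0 ≤ σ p) (hκ : ∀ p ∈ s, ∀ q ∈ s, 0 ≤ κ p q)
    (hcov : ∀ p ∈ s, ∀ q ∈ s, lvl p = lvl q →
      |∫ ω, X p ω * X q ω ∂μ| ≤ κ p q * (σ p * σ q))
    (hrow : ∀ p ∈ s, ∑ q ∈ s.filter (fun q => lvl q = lvl p), κ p q ≤ B)
    (hcol : ∀ p ∈ s, ∑ q ∈ s.filter (fun q => lvl q = lvl p), κ q p ≤ B) (Λ : ℝ) :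
    TowerDecorrelation μ s X σ (sameLevel lvl κ) lvl B Λ 0 := by
  have hP := pairDecorrelation_sameLevel hF hFle hXm hXb hXc hσ hκ hcov hrow hcol
  refine ⟨hP.σ_nonneg, hP.κ_nonneg, hP.cov_le, fun p hp g => ?_, fun p hp g => ?_⟩
  · rcases Nat.eq_zero_or_pos g with rfl | hg
    · have hfilt : s.filter (fun q => lvl q + 0 = lvl p) = s.filter (fun q => lvl q = lvl p) :=
        filter_congr fun q _ => by rw [add_zero]
      rw [pow_zero, mul_one, hfilt]
      calc ∑ q ∈ s.filter (fun q => lvl q = lvl p), sameLevel lvl κ p q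
          = ∑ q ∈ s.filter (fun q => lvl q = lvl p), κ p q :=
            sum_congr rfl fun q hq => sameLevel_of_eq (mem_filter.mp hq).2.symm
        _ ≤ B := hrow p hp
    · have hzero : ∑ q ∈ s.filter (fun q => lvl q + g = lvl p), sameLevel lvl κ p q = 0 :=
        sum_eq_zero fun q hq => sameLevel_of_ne (by have h := (mem_filter.mp hq).2; omega)
      simp only [hzero, mul_zero, zero_pow hg.ne', le_refl]
  · rcases Nat.eq_zero_or_pos g with rfl | hg
    · have hfilt : s.filter (fun q => lvl q + 0 = lvl p) = s.filter (fun q => lvl q = lvl p) :=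
        filter_congr fun q _ => by rw [add_zero]
      rw [pow_zero, mul_one, hfilt]
      calc ∑ q ∈ s.filter (fun q => lvl q = lvl p), sameLevel lvl κ q p
          = ∑ q ∈ s.filter (fun q => lvl q = lvl p), κ q p :=
            sum_congr rfl fun q hq => sameLevel_of_eq (mem_filter.mp hq).2
        _ ≤ B := hcol p hp
    · have hzero : ∑ q ∈ s.filter (fun q => lvl q + g = lvl p), sameLevel lvl κ q p = 0 :=
        sum_eq_zero fun q hq => sameLevel_of_ne (by have h := (mem_filter.mp hq).2; omega)
      simp only [hzero, mul_zero, zero_pow hg.ne', le_refl]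

/-- (K14m) [folklore] **SECOND MOMENT FOR CONDITIONALLY CENTRED LEVELLED PIECES.**
`∫ (Σ_p c_p X_p)² dμ ≤ B · Σ_p (c_p σ_p)²` with the level-local number `B` (K5's
`PairDecorrelation.integral_sq_sum_le` BY NAME on the instance (K14k)). -/
theorem integral_sq_sum_le_of_condCentred [IsFiniteMeasure μ] (hF : Antitone F)
    (hFle : ∀ j, F j ≤ mΩ) (hXm : ∀ p ∈ s, StronglyMeasurable[F (lvl p)] (X p))
    (hXb : ∀ p ∈ s, ∀ ω, |X p ω| ≤ b p) (hXc : ∀ p ∈ s, μ[X p | F (lvl p + 1)] =ᵐ[μ] 0)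
    (hσ : ∀ p ∈ s, 0 ≤ σ p) (hκ : ∀ p ∈ s, ∀ q ∈ s, 0 ≤ κ p q)
    (hcov : ∀ p ∈ s, ∀ q ∈ s, lvl p = lvl q →
      |∫ ω, X p ω * X q ω ∂μ| ≤ κ p q * (σ p * σ q))
    (hrow : ∀ p ∈ s, ∑ q ∈ s.filter (fun q => lvl q = lvl p), κ p q ≤ B)
    (hcol : ∀ p ∈ s, ∑ q ∈ s.filter (fun q => lvl q = lvl p), κ q p ≤ B) (c : ι → ℝ) :
    ∫ ω, (∑ p ∈ s, c p * X p ω) ^ 2 ∂μ ≤ B * ∑ p ∈ s, (c p * σ p) ^ 2 :=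
  (pairDecorrelation_sameLevel hF hFle hXm hXb hXc hσ hκ hcov hrow hcol).integral_sq_sum_le
    (fun _ hp _ hq =>
      integrable_mul_of_abs_le (aestronglyMeasurable_of_level hFle hXm) hXb hp hq) c

/-- (K14m′) [folklore] **HEADLINE FOR CONDITIONALLY CENTRED LEVELLED PIECES** (probability
measure): under the K11a level bookkeeping (counts `≤ N₀Λ^{k−j}`, squared budgets
`(c_pσ_p)² ≤ A(τ²)^{K−lvl p}`, `Λτ² ≤ r < 1`) and `Σ|c_p|b_p ≤ 1`,
`0 ≤ log ∫ exp(−Σ c_pX_p) dμ ≤ B · N₀A/(1−r)` — K5's headline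
`PairDecorrelation.log_integral_exp_neg_sum_le_line` BY NAME, with NO cross-gap condition: for
conditionally centred pieces the instance of NE1(ii)-DECORR is the level-local number `B`
alone.  Hypothesis shapes only; `B` for Bałaban's laws is NOT estimated here. -/
theorem log_integral_exp_neg_sum_le_line_of_condCentred [IsProbabilityMeasure μ]
    (hF : Antitone F) (hFle : ∀ j, F j ≤ mΩ)
    (hXm : ∀ p ∈ s, StronglyMeasurable[F (lvl p)] (X p)) (hXb : ∀ p ∈ s, ∀ ω, |X p ω| ≤ b p)
    (hXc : ∀ p ∈ s, μ[X p | F (lvl p + 1)] =ᵐ[μ] 0) (hσ : ∀ p ∈ s, 0 ≤ σ p)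
    (hκ : ∀ p ∈ s, ∀ q ∈ s, 0 ≤ κ p q)
    (hcov : ∀ p ∈ s, ∀ q ∈ s, lvl p = lvl q →
      |∫ ω, X p ω * X q ω ∂μ| ≤ κ p q * (σ p * σ q))
    (hrow : ∀ p ∈ s, ∑ q ∈ s.filter (fun q => lvl q = lvl p), κ p q ≤ B)
    (hcol : ∀ p ∈ s, ∑ q ∈ s.filter (fun q => lvl q = lvl p), κ q p ≤ B) (hB : 0 ≤ B)
    {c : ι → ℝ} (hc1 : ∑ p ∈ s, |c p| * b p ≤ 1) {N₀ A τ r : ℝ} {K k : ℕ} (hk : k ≤ K)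
    (hlvl : ∀ p ∈ s, lvl p ≤ k)
    (hcard : ∀ j, j ≤ k → ((s.filter fun p => lvl p = j).card : ℝ) ≤ N₀ * Λ ^ (k - j))
    (hN₀ : 0 ≤ N₀) (hA : 0 ≤ A) (hΛ : 0 ≤ Λ) (hτ0 : 0 ≤ τ) (hτ1 : τ ≤ 1)
    (hr : Λ * τ ^ 2 ≤ r) (hr1 : r < 1)
    (hw : ∀ p ∈ s, (c p * σ p) ^ 2 ≤ A * (τ ^ 2) ^ (K - lvl p)) :
    0 ≤ Real.log (∫ ω, Real.exp (-∑ p ∈ s, c p * X p ω) ∂μ) ∧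
      Real.log (∫ ω, Real.exp (-∑ p ∈ s, c p * X p ω) ∂μ) ≤ B * (N₀ * A / (1 - r)) :=
  (pairDecorrelation_sameLevel hF hFle hXm hXb hXc hσ hκ hcov hrow hcol)
    |>.log_integral_exp_neg_sum_le_line hB (aestronglyMeasurable_of_level hFle hXm) hXb
      (fun _ hp => integral_eq_zero_of_condExp_ae_eq_zero hFle hXc hp) hc1 lvl hk hlvl hcard
      hN₀ hA hΛ hτ0 hτ1 hr hr1 hw

/-- (K14n) [folklore] The MEAN-CHANNEL KERNEL: on a pair `(p, q)` with `lvl q ≤ lvl p` it is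
`κ₀(p,q)·ν^{lvl p − lvl q}`, and on the other pairs the transposed entry — every pair is read
from its COARSER end. -/
def meanKernel (lvl : ι → ℕ) (κ₀ : ι → ι → ℝ) (ν : ℝ) (p q : ι) : ℝ :=
  if lvl q ≤ lvl p then κ₀ p q * ν ^ (lvl p - lvl q) else κ₀ q p * ν ^ (lvl q - lvl p)

/-- (K14w) [folklore] **K6's LEVELLED CLAUSE FROM THE MEAN CHANNEL.**  Hypotheses (shapes, none
estimated, none printed): a levelled bounded family along an antitone filtration; a nonnegative
kernel `κ₀` and `0 ≤ ν` such that (hmean) each piece `X_p` is decorrelated AT ITS OWN LEVEL from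
the conditional means `μ[X_q | F (lvl p)]` of the pieces `q` at finer-or-equal levels, with the
smoothed piece's scale `ν^{gap}·σ_q`:
`|∫ X_p · μ[X_q | F (lvl p)] dμ| ≤ κ₀(p,q)·ν^{lvl p − lvl q}·σ_pσ_q`; (hdown) down-slice sums
`Σ_{q : lvl q + g = lvl p} κ₀(p,q) ≤ B·Λ^g` (nested counts × same-level decay); (hsameT) the
transposed same-level sum `Σ_{q : lvl q = lvl p} κ₀(q,p) ≤ B`.  CONCLUSION: K6's shape
`TowerDecorrelation μ s X σ (meanKernel lvl κ₀ ν) lvl B Λ ν` — by (K14h) the covariance IS the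
channel, and both orientations of K6's clause are booked from the coarse end, so the transposed
clause needs nothing across gaps.  READING (R1): the cross-gap number ν is the one-body
contraction of conditional means up the tower; this theorem is the bookkeeping of that
re-routing, NOT an estimate. -/
theorem towerDecorrelation_of_meanChannel [IsFiniteMeasure μ] (hFle : ∀ j, F j ≤ mΩ)
    (hXm : ∀ p ∈ s, StronglyMeasurable[F (lvl p)] (X p)) (hXb : ∀ p ∈ s, ∀ ω, |X p ω| ≤ b p)
    (hσ : ∀ p ∈ s, 0 ≤ σ p) {κ₀ : ι → ι → ℝ} (hκ₀ : ∀ p ∈ s, ∀ q ∈ s, 0 ≤ κ₀ p q) {ν : ℝ}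
    (hν : 0 ≤ ν)
    (hmean : ∀ p ∈ s, ∀ q ∈ s, lvl q ≤ lvl p →
      |∫ ω, X p ω * μ[X q | F (lvl p)] ω ∂μ| ≤ κ₀ p q * ν ^ (lvl p - lvl q) * (σ p * σ q))
    (hdown : ∀ p ∈ s, ∀ g : ℕ, ∑ q ∈ s.filter (fun q => lvl q + g = lvl p), κ₀ p q ≤ B * Λ ^ g)
    (hsameT : ∀ p ∈ s, ∑ q ∈ s.filter (fun q => lvl q = lvl p), κ₀ q p ≤ B) :
    TowerDecorrelation μ s X σ (meanKernel lvl κ₀ ν) lvl B Λ ν := by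
  -- the gap-`g` down-slice, read through the channel: every term is `κ₀ p q * ν ^ g`
  have hslice : ∀ p ∈ s, ∀ g : ℕ, ∀ f : ι → ℝ,
      (∀ q ∈ s.filter (fun q => lvl q + g = lvl p), f q = κ₀ p q * ν ^ g) →
      ∑ q ∈ s.filter (fun q => lvl q + g = lvl p), f q ≤ B * (Λ * ν) ^ g := by
    intro p hp g f hf
    calc ∑ q ∈ s.filter (fun q => lvl q + g = lvl p), f q
        = ∑ q ∈ s.filter (fun q => lvl q + g = lvl p), κ₀ p q * ν ^ g := sum_congr rfl hf
      _ = (∑ q ∈ s.filter (fun q => lvl q + g = lvl p), κ₀ p q) * ν ^ g := by rw [sum_mul]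
      _ ≤ B * Λ ^ g * ν ^ g := mul_le_mul_of_nonneg_right (hdown p hp g) (pow_nonneg hν g)
      _ = B * (Λ * ν) ^ g := by rw [mul_pow]; ring
  refine ⟨hσ, fun p hp q hq => ?_, fun p hp q hq => ?_, fun p hp g => ?_, fun p hp g => ?_⟩
  · -- κ ≥ 0
    unfold meanKernel
    by_cases h : lvl q ≤ lvl p
    · rw [if_pos h]; exact mul_nonneg (hκ₀ p hp q hq) (pow_nonneg hν _)
    · rw [if_neg h]; exact mul_nonneg (hκ₀ q hq p hp) (pow_nonneg hν _)
  · -- cov_le through the channel, from the coarser end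
    unfold meanKernel
    by_cases h : lvl q ≤ lvl p
    · rw [if_pos h, integral_mul_eq_integral_mul_condExp_level hFle hXm hXb hp hq]
      exact hmean p hp q hq h
    · have h' : lvl p ≤ lvl q := Nat.le_of_lt (Nat.lt_of_not_le h)
      have hc : (fun ω => X p ω * X q ω) = fun ω => X q ω * X p ω :=
        funext fun ω => mul_comm _ _
      rw [if_neg h, hc, integral_mul_eq_integral_mul_condExp_level hFle hXm hXb hq hp,
        mul_comm (σ p) (σ q)]
      exact hmean q hq p hp h'
  · -- down_le
    refine hslice p hp g _ fun q hq => ?_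
    have h := (mem_filter.mp hq).2
    have hle : lvl q ≤ lvl p := by omega
    have hsub : lvl p - lvl q = g := by omega
    unfold meanKernel
    rw [if_pos hle, hsub]
  · -- downT_le : g = 0 is the transposed same-level sum, g ≥ 1 is down_le again
    rcases Nat.eq_zero_or_pos g with rfl | hg
    · have hfilt : s.filter (fun q => lvl q + 0 = lvl p) = s.filter (fun q => lvl q = lvl p) :=
        filter_congr fun q _ => by rw [add_zero]
      rw [pow_zero, mul_one, hfilt]
      calc ∑ q ∈ s.filter (fun q => lvl q = lvl p), meanKernel lvl κ₀ ν q p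
          = ∑ q ∈ s.filter (fun q => lvl q = lvl p), κ₀ q p :=
            sum_congr rfl fun q hq => by
              have h := (mem_filter.mp hq).2
              have hsub : lvl q - lvl p = 0 := by omega
              unfold meanKernel
              rw [if_pos h.ge, hsub, pow_zero, mul_one]
        _ ≤ B := hsameT p hp
    · refine hslice p hp g _ fun q hq => ?_
      have h := (mem_filter.mp hq).2
      have hnot : ¬ (lvl p ≤ lvl q) := by omega
      have hsub : lvl p - lvl q = g := by omega
      unfold meanKernel
      rw [if_neg hnot, hsub]

end Levels

/-! ## §3  Doob–Lévy increments along the filtration (K14o–K14u) -/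

section Increments

variable {Ω : Type*} {mΩ : MeasurableSpace Ω} {μ : Measure Ω} {F : ℕ → MeasurableSpace Ω}

/-- (K14o) [folklore] The level-`i` INCREMENT of an observable along the filtration:
`μ[f | F i] − μ[f | F (i + 1)]` (the part of `f`'s conditional mean that lives exactly at
level `i`). -/
def incr (μ : Measure Ω) (F : ℕ → MeasurableSpace Ω) (f : Ω → ℝ) (i : ℕ) : Ω → ℝ :=
  μ[f | F i] - μ[f | F (i + 1)]

/-- [folklore] -/
theorem incr_apply (f : Ω → ℝ) (i : ℕ) (ω : Ω) :
    incr μ F f i ω = μ[f | F i] ω - μ[f | F (i + 1)] ω := rfl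

/-- (K14o′) [folklore] Increments are adapted: `incr μ F f i` is `F i`-measurable when `F` is
antitone. -/
theorem stronglyMeasurable_incr (hF : Antitone F) (f : Ω → ℝ) (i : ℕ) :
    StronglyMeasurable[F i] (incr μ F f i) :=
  (stronglyMeasurable_condExp (m := F i) (μ := μ) (f := f)).sub
    ((stronglyMeasurable_condExp (m := F (i + 1)) (μ := μ) (f := f)).mono (hF (Nat.le_succ i)))

/-- [folklore] -/
theorem integrable_incr (f : Ω → ℝ) (i : ℕ) : Integrable (incr μ F f i) μ :=
  (integrable_condExp (m := F i) (μ := μ) (f := f)).sub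
    (integrable_condExp (m := F (i + 1)) (μ := μ) (f := f))

/-- [folklore] -/
theorem aestronglyMeasurable_incr (hF : Antitone F) (hFle : ∀ j, F j ≤ mΩ) (f : Ω → ℝ)
    (i : ℕ) : AEStronglyMeasurable (incr μ F f i) μ :=
  ((stronglyMeasurable_incr (μ := μ) hF f i).mono (hFle i)).aestronglyMeasurable

/-- (K14p) [folklore] **INCREMENTS ARE CONDITIONALLY CENTRED ONE LEVEL UP** (tower property):
`μ[incr μ F f i | F (i + 1)] =ᵐ 0`. -/
theorem condExp_incr_ae_eq_zero [IsFiniteMeasure μ] (hF : Antitone F) (hFle : ∀ j, F j ≤ mΩ)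
    (f : Ω → ℝ) (i : ℕ) : μ[incr μ F f i | F (i + 1)] =ᵐ[μ] 0 := by
  haveI : SigmaFinite (μ.trim (hFle i)) := inferInstance
  haveI : SigmaFinite (μ.trim (hFle (i + 1))) := inferInstance
  have h1 : μ[μ[f | F i] | F (i + 1)] =ᵐ[μ] μ[f | F (i + 1)] :=
    condExp_condExp_of_le (hF (Nat.le_succ i)) (hFle i)
  have h2 : μ[μ[f | F (i + 1)] | F (i + 1)] = μ[f | F (i + 1)] :=
    condExp_of_stronglyMeasurable (hFle (i + 1)) stronglyMeasurable_condExp integrable_condExp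
  have h3 : μ[incr μ F f i | F (i + 1)] =ᵐ[μ]
      μ[μ[f | F i] | F (i + 1)] - μ[μ[f | F (i + 1)] | F (i + 1)] :=
    condExp_sub (integrable_condExp (m := F i) (μ := μ) (f := f))
      (integrable_condExp (m := F (i + 1)) (μ := μ) (f := f)) (F (i + 1))
  filter_upwards [h3, h1] with ω h3ω h1ω
  rw [h3ω, Pi.sub_apply, h1ω, h2, Pi.zero_apply, sub_self]

/-- (K14q) [folklore] Increments of a bounded observable are a.e. bounded by twice the bound. -/
theorem ae_abs_incr_le {f : Ω → ℝ} {R : ℝ} (hf : ∀ ω, |f ω| ≤ R) (i : ℕ) :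
    ∀ᵐ ω ∂μ, |incr μ F f i ω| ≤ 2 * R := by
  filter_upwards [ae_abs_condExp_le (μ := μ) (m := F i) hf,
    ae_abs_condExp_le (μ := μ) (m := F (i + 1)) hf] with ω h1 h2
  rw [incr_apply]
  obtain ⟨h1l, h1u⟩ := abs_le.mp h1
  obtain ⟨h2l, h2u⟩ := abs_le.mp h2
  exact abs_le.mpr ⟨by linarith, by linarith⟩

/-- [folklore] Products of increments of bounded observables are integrable. -/
theorem integrable_incr_mul_incr (hF : Antitone F) (hFle : ∀ j, F j ≤ mΩ) {f : Ω → ℝ} {R : ℝ}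
    (hf : ∀ ω, |f ω| ≤ R) (g : Ω → ℝ) (i i' : ℕ) :
    Integrable (fun ω => incr μ F f i ω * incr μ F g i' ω) μ :=
  ((integrable_incr (μ := μ) (F := F) g i').mul_bdd (aestronglyMeasurable_incr hF hFle f i)
    ((ae_abs_incr_le hf i).mono fun ω h => by rw [Real.norm_eq_abs]; exact h)).congr
    (ae_of_all μ fun ω => mul_comm (incr μ F g i' ω) (incr μ F f i ω))

/-- (K14r) [folklore] **ν = 0 FOR INCREMENTS.**  Increments of two bounded observables at
DIFFERENT levels are orthogonal — with no hypothesis on the law beyond finiteness.  READING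
(R3): along the tower filtration the Doob–Lévy pieces of all observables decouple exactly
across levels; what a decorrelation estimate must control is the SAME-LEVEL budget of the
increments and their SIZES at the levels where they live. -/
theorem integral_incr_mul_incr_eq_zero [IsFiniteMeasure μ] (hF : Antitone F)
    (hFle : ∀ j, F j ≤ mΩ) {f g : Ω → ℝ} {Rf Rg : ℝ} (hf : ∀ ω, |f ω| ≤ Rf)
    (hg : ∀ ω, |g ω| ≤ Rg) {i i' : ℕ} (hne : i ≠ i') :
    ∫ ω, incr μ F f i ω * incr μ F g i' ω ∂μ = 0 := by
  rcases hne.lt_or_gt with h | h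
  · have hc : (fun ω => incr μ F f i ω * incr μ F g i' ω) =
        fun ω => incr μ F g i' ω * incr μ F f i ω := funext fun ω => mul_comm _ _
    rw [hc]
    exact integral_mul_eq_zero_of_level_lt hF hFle h (stronglyMeasurable_incr hF g i')
      (integrable_incr f i) (integrable_incr_mul_incr hF hFle hg f i' i)
      (condExp_incr_ae_eq_zero hF hFle f i)
  · exact integral_mul_eq_zero_of_level_lt hF hFle h (stronglyMeasurable_incr hF f i)
      (integrable_incr g i') (integrable_incr_mul_incr hF hFle hf g i i')
      (condExp_incr_ae_eq_zero hF hFle g i')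

/-- (K14s) [folklore] TELESCOPING: `μ[f | F j] = μ[f | F (j + n)] + Σ_{i < n} incr (j + i)`
pointwise. -/
theorem condExp_eq_condExp_add_sum_incr (f : Ω → ℝ) (j n : ℕ) (ω : Ω) :
    μ[f | F j] ω = μ[f | F (j + n)] ω + ∑ i ∈ range n, incr μ F f (j + i) ω := by
  induction n with
  | zero => simp
  | succ n ih =>
    rw [sum_range_succ, ih]
    have h : incr μ F f (j + n) ω = μ[f | F (j + n)] ω - μ[f | F (j + (n + 1))] ω := by
      rw [← add_assoc]; rfl
    rw [h]; ring

/-- (K14t) [folklore] **EXACT LEVEL DECOUPLING OF THE SECOND MOMENT.**  For summands `S i`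
adapted to level `i` and conditionally centred one level up (with the obvious integrability),
`∫ (Σ_{i∈t} S i)² dμ = Σ_{i∈t} ∫ (S i)² dμ` — the cross terms vanish by (K14g). -/
theorem integral_sq_sum_eq_sum_integral_sq [IsFiniteMeasure μ] (hF : Antitone F)
    (hFle : ∀ j, F j ≤ mΩ) {t : Finset ℕ} {S : ℕ → Ω → ℝ}
    (hSm : ∀ i ∈ t, StronglyMeasurable[F i] (S i)) (hSi : ∀ i ∈ t, Integrable (S i) μ)
    (hint : ∀ i ∈ t, ∀ i' ∈ t, Integrable (fun ω => S i ω * S i' ω) μ)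
    (hSc : ∀ i ∈ t, μ[S i | F (i + 1)] =ᵐ[μ] 0) :
    ∫ ω, (∑ i ∈ t, S i ω) ^ 2 ∂μ = ∑ i ∈ t, ∫ ω, S i ω ^ 2 ∂μ := by
  have hexp : ∀ ω, (∑ i ∈ t, S i ω) ^ 2 = ∑ i ∈ t, ∑ i' ∈ t, S i ω * S i' ω := fun ω => by
    rw [sq, sum_mul_sum]
  have hI : ∫ ω, (∑ i ∈ t, S i ω) ^ 2 ∂μ = ∑ i ∈ t, ∑ i' ∈ t, ∫ ω, S i ω * S i' ω ∂μ := by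
    simp_rw [hexp]
    rw [integral_finsetSum _ fun i hi => integrable_finsetSum _ fun i' hi' => hint i hi i' hi']
    exact sum_congr rfl fun i hi => integral_finsetSum _ fun i' hi' => hint i hi i' hi'
  rw [hI]
  refine sum_congr rfl fun i hi => ?_
  rw [sum_eq_single_of_mem i hi]
  · exact integral_congr_ae (ae_of_all μ fun ω => (sq (S i ω)).symm)
  · intro i' hi' hne
    rcases hne.lt_or_gt with h | h
    · exact integral_mul_eq_zero_of_level_lt hF hFle h (hSm i hi) (hSi i' hi') (hint i hi i' hi')
        (hSc i' hi')
    · have hc : (fun ω => S i ω * S i' ω) = fun ω => S i' ω * S i ω :=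
        funext fun ω => mul_comm _ _
      rw [hc]
      exact integral_mul_eq_zero_of_level_lt hF hFle h (hSm i' hi') (hSi i hi) (hint i' hi' i hi)
        (hSc i hi)

/-- (K14u) [folklore] **VARIANCE OF A CONDITIONAL-MEAN DIFFERENCE = SUM OF THE INCREMENTS'
SECOND MOMENTS**: `∫ (μ[f | F j] − μ[f | F (j+n)])² dμ = Σ_{i<n} ∫ (incr (j+i))² dμ` for every
bounded `f` (K14s + K14t along the shifted filtration `i ↦ F (j + i)`). -/
theorem integral_sq_condExp_sub_eq_sum [IsFiniteMeasure μ] (hF : Antitone F)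
    (hFle : ∀ j, F j ≤ mΩ) {f : Ω → ℝ} {R : ℝ} (hf : ∀ ω, |f ω| ≤ R) (j n : ℕ) :
    ∫ ω, (μ[f | F j] ω - μ[f | F (j + n)] ω) ^ 2 ∂μ =
      ∑ i ∈ range n, ∫ ω, incr μ F f (j + i) ω ^ 2 ∂μ := by
  have htel : ∀ ω, μ[f | F j] ω - μ[f | F (j + n)] ω = ∑ i ∈ range n, incr μ F f (j + i) ω :=
    fun ω => by rw [condExp_eq_condExp_add_sum_incr f j n ω]; ring
  simp_rw [htel]
  have hF' : Antitone fun i => F (j + i) := fun a a' h => hF (Nat.add_le_add_left h j)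
  exact integral_sq_sum_eq_sum_integral_sq (F := fun i => F (j + i))
    (S := fun i => incr μ F f (j + i)) hF' (fun i => hFle (j + i))
    (fun i _ => stronglyMeasurable_incr hF f (j + i)) (fun i _ => integrable_incr f (j + i))
    (fun i _ i' _ => integrable_incr_mul_incr hF hFle hf f (j + i) (j + i'))
    (fun i _ => condExp_incr_ae_eq_zero hF hFle f (j + i))

/-- (K14x) [folklore] **NON-VACUITY / RE-FILING WITNESS.**  The increments of ANY family of
observables `f a`, indexed by (observable, level) and filed at the level where they live
(`lvl := Prod.snd`), satisfy the standing hypotheses of §2: level-adaptedness (hXm) and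
conditional centring one level up (hXc) — so (K14i)–(K14m) apply to them with ν = 0 (READING
(R3); the bound (hXb) holds a.e. with `2R`, (K14q)).  Nothing estimated. -/
theorem incr_family_levelled [IsFiniteMeasure μ] (hF : Antitone F) (hFle : ∀ j, F j ≤ mΩ)
    {α : Type*} (f : α → Ω → ℝ) (t : Finset (α × ℕ)) :
    (∀ x ∈ t, StronglyMeasurable[F (Prod.snd x)] (incr μ F (f x.1) x.2)) ∧
      (∀ x ∈ t, μ[incr μ F (f x.1) x.2 | F (Prod.snd x + 1)] =ᵐ[μ] 0) ∧
      (∀ x ∈ t, ∀ y ∈ t, Prod.snd x ≠ Prod.snd y →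
        (∀ {Rx Ry : ℝ}, (∀ ω, |f x.1 ω| ≤ Rx) → (∀ ω, |f y.1 ω| ≤ Ry) →
          ∫ ω, incr μ F (f x.1) x.2 ω * incr μ F (f y.1) y.2 ω ∂μ = 0)) :=
  ⟨fun x _ => stronglyMeasurable_incr hF (f x.1) x.2,
    fun x _ => condExp_incr_ae_eq_zero hF hFle (f x.1) x.2,
    fun _ _ _ _ hne _ _ hx hy => integral_incr_mul_incr_eq_zero hF hFle hx hy hne⟩

end Increments

/-! ## §4  The blockwise reading (calibration, K14v) -/

section Blockwise

variable {Ω : Type*} {mΩ : MeasurableSpace Ω} {μ : Measure Ω} {ι : Type*} {s : Finset ι}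
  {X : ι → Ω → ℝ} {b σ : ι → ℝ}

/-- (K14v) [folklore] **BLOCKWISE CONDITIONAL CENTRING ⇒ ORTHOGONALITY.**  If each piece `X_q`
is centred given a σ-algebra `G q` with respect to which every OTHER piece is measurable
(Dobrushin-type: `G q` = the field outside `q`'s support, pieces with disjoint supports), then
distinct pieces are orthogonal.  READING (R4): the measurability hypothesis `hXG` is what FAILS
for Doob-corrected pieces, which is why §2–§3 use the nested filtration instead. -/
theorem integral_mul_eq_zero_of_blockCentred [IsFiniteMeasure μ] {G : ι → MeasurableSpace Ω}
    (hG : ∀ q ∈ s, G q ≤ mΩ) (hXm : ∀ p ∈ s, AEStronglyMeasurable (X p) μ)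
    (hXb : ∀ p ∈ s, ∀ ω, |X p ω| ≤ b p)
    (hXG : ∀ p ∈ s, ∀ q ∈ s, p ≠ q → StronglyMeasurable[G q] (X p))
    (hXc : ∀ q ∈ s, μ[X q | G q] =ᵐ[μ] 0) {p q : ι} (hp : p ∈ s) (hq : q ∈ s) (hpq : p ≠ q) :
    ∫ ω, X p ω * X q ω ∂μ = 0 := by
  haveI : SigmaFinite (μ.trim (hG q hq)) := inferInstance
  exact integral_mul_eq_zero_of_condExp_ae_eq_zero (hG q hq) (hXG p hp q hq hpq)
    (integrable_of_abs_le (hXm q hq) (hXb q hq)) (integrable_mul_of_abs_le hXm hXb hp hq) (hXc q hq)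

/-- (K14v′) [folklore] … hence K5's shape at `C = 1` with the diagonal kernel
(`PairDecorrelation.of_uncorrelated` BY NAME). -/
theorem pairDecorrelation_of_blockCentred [IsFiniteMeasure μ] [DecidableEq ι]
    {G : ι → MeasurableSpace Ω} (hG : ∀ q ∈ s, G q ≤ mΩ)
    (hXm : ∀ p ∈ s, AEStronglyMeasurable (X p) μ) (hXb : ∀ p ∈ s, ∀ ω, |X p ω| ≤ b p)
    (hXG : ∀ p ∈ s, ∀ q ∈ s, p ≠ q → StronglyMeasurable[G q] (X p))
    (hXc : ∀ q ∈ s, μ[X q | G q] =ᵐ[μ] 0) (hσ : ∀ p ∈ s, 0 ≤ σ p)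
    (hdiag : ∀ p ∈ s, |∫ ω, X p ω * X p ω ∂μ| ≤ σ p * σ p) :
    PairDecorrelation μ s X σ (fun p q => if p = q then 1 else 0) 1 :=
  PairDecorrelation.of_uncorrelated hσ
    (fun _ hp _ hq hpq => integral_mul_eq_zero_of_blockCentred hG hXm hXb hXG hXc hp hq hpq)
    hdiag

end Blockwise

end Literature.MathematicalPhysics.QuantumFieldTheory.Balaban1983to89.T4MeanChannel

end
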